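import Mathlib
import Summits.ResolutionOfSingularities.ResolutionOfSingularities.Theorems.RisoStrataRisoCentresResolvePlumbing

/-!
# Route RisoStrata — crux `RisoCentresResolve` (stmt-ResolutionOfSingularities-18546), line `Sketch`,
# stub `stub_rcrRefine`: common basic-open refinement of two charts with the same local ring

Two finitely generated `k`-subalgebras `B, B' ⊆ O` of the function field `K` with the same local
ring at the centre of the valuation ring `O` (`risoLoc O B = risoLoc O B'`) have a common
basic-open refinement: `B' ⊆ B[s⁻¹]` and `B ⊆ B'[s'⁻¹]` with `s ∈ B`, `s' ∈ B'` units of `O`.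

Proof sketch ("clear the finitely many denominators"):

* one-sided lemma `refine_oneSided`: if `B ⊆ O`, `B'` is finitely generated and
  `B' ⊆ risoLoc O B`, write each of the finitely many generators `y` of `B'` as `y = a_y / z_y`
  with `a_y, z_y ∈ B` and `ν(z_y) = 0` (bridge `risoLoc_toSubring_eq` to the tree's
  `locAtCentre` and `mem_locAtCentre_iff`); then `s := ∏ z_y ∈ B` has value `1`, so `s ≠ 0`,
  `s⁻¹ ∈ O`, and `y = (y z_y) · (∏_{y' ≠ y} z_{y'}) · s⁻¹ ∈ k[B ∪ {s⁻¹}]`, whence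
  `B' = k[generators] ⊆ k[B ∪ {s⁻¹}]`;
* apply it to `B' ⊆ risoLoc O B' = risoLoc O B` and symmetrically to `B ⊆ risoLoc O B'`.
-/

noncomputable section

set_option linter.dupNamespace false -- mandated namespace of this single-conjunct summit

namespace Summit.ResolutionOfSingularities.ResolutionOfSingularities.Theorems

open Literature.AlgebraicGeometry.Resolution

/-- **One-sided refinement (clearing denominators)**: if `B ⊆ O` and a finitely generated `B'`
lies in the local ring `risoLoc O B` of `B` at the centre of `O`, then `B' ⊆ k[B ∪ {s⁻¹}]` for
some `s ∈ B`, `s ≠ 0`, with `s⁻¹ ∈ O` (the product of the denominators of the generators).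
[folklore] -/
theorem refine_oneSided {k K : Type} [Field k] [Field K] [Algebra k K] (O : ValuationSubring K)
    {B B' : Subalgebra k K} (hBO : B.toSubring ≤ O.toSubring) (hB' : B'.FG)
    (hle : B' ≤ risoLoc O B) :
    ∃ s : K, s ∈ B ∧ s ≠ 0 ∧ s⁻¹ ∈ O ∧
      (B' : Set K) ⊆ Algebra.adjoin k ((B : Set K) ∪ {s⁻¹}) := by
  classical
  obtain ⟨t, ht⟩ := hB'
  -- each generator `y ∈ t` is a fraction `a / z` over `B` with `ν(z) = 0`; off `t` take `z = 1`
  have key : ∀ y : K, ∃ z : K, z ∈ B ∧ O.valuation z = 1 ∧ (y ∈ t → y * z ∈ B) := by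
    intro y
    by_cases hy : y ∈ t
    · have hy' : y ∈ risoLoc O B := hle (ht ▸ Algebra.subset_adjoin (Finset.mem_coe.mpr hy))
      have hy'' : y ∈ (risoLoc O B).toSubring := hy'
      rw [risoLoc_toSubring_eq hBO, mem_locAtCentre_iff] at hy''
      obtain ⟨a, ha, z, hz, hv, rfl⟩ := hy''
      refine ⟨z, hz, hv, fun _ => ?_⟩
      rw [div_mul_cancel₀ a (ne_zero_of_valuation_eq_one hv)]
      exact ha
    · exact ⟨1, B.one_mem, map_one _, fun h => absurd h hy⟩
  choose z hzB hzv hzy using key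
  -- the common denominator
  obtain ⟨s, hs⟩ : ∃ s : K, s = ∏ y ∈ t, z y := ⟨_, rfl⟩
  have hsB : s ∈ B := hs ▸ prod_mem fun y _ => hzB y
  have hv : O.valuation s = 1 := by
    rw [hs, map_prod]
    exact Finset.prod_eq_one fun y _ => hzv y
  have hs0 : s ≠ 0 := ne_zero_of_valuation_eq_one hv
  have hsO : s⁻¹ ∈ O := by
    rw [← O.valuation_le_one_iff, map_inv₀, hv, inv_one]
  refine ⟨s, hsB, hs0, hsO, ?_⟩
  change B' ≤ Algebra.adjoin k ((B : Set K) ∪ {s⁻¹})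
  rw [← ht]
  refine Algebra.adjoin_le ?_
  intro y hy
  have hy : y ∈ t := Finset.mem_coe.mp hy
  -- `y = (y z_y) · (∏_{y' ≠ y} z_{y'}) · s⁻¹`
  have hyeq : y = (y * z y) * (∏ y' ∈ t.erase y, z y') * s⁻¹ := by
    rw [mul_assoc y, Finset.mul_prod_erase t z hy, ← hs, mul_assoc, mul_inv_cancel₀ hs0, mul_one]
  rw [hyeq]
  refine Subalgebra.mul_mem _ (Subalgebra.mul_mem _ ?_ ?_) ?_
  · exact Algebra.subset_adjoin (Set.mem_union_left _ (hzy y hy))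
  · exact Algebra.subset_adjoin (Set.mem_union_left _ (prod_mem fun y' _ => hzB y'))
  · exact Algebra.subset_adjoin (Set.mem_union_right _ (Set.mem_singleton _))

/-- **Common basic-open refinement** of two finitely generated charts `B, B' ⊆ O` with the same
local ring at the centre of the valuation ring `O`: there are `s ∈ B`, `s' ∈ B'`, nonzero units
of `O`, with `B' ⊆ k[B ∪ {s⁻¹}]` and `B ⊆ k[B' ∪ {s'⁻¹}]`. [folklore] -/
theorem stub_rcrRefine {k K : Type} [Field k] [Field K] [Algebra k K]
    (O : ValuationSubring K) (B B' : Subalgebra k K) (hB : B.FG) (hB' : B'.FG)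
    (hBO : B.toSubring ≤ O.toSubring) (hB'O : B'.toSubring ≤ O.toSubring)
    (hloc : risoLoc O B = risoLoc O B') :
    ∃ s s' : K, s ∈ B ∧ s' ∈ B' ∧ s ≠ 0 ∧ s' ≠ 0 ∧ s⁻¹ ∈ O ∧ s'⁻¹ ∈ O ∧
      (B' : Set K) ⊆ Algebra.adjoin k ((B : Set K) ∪ {s⁻¹}) ∧
      (B : Set K) ⊆ Algebra.adjoin k ((B' : Set K) ∪ {s'⁻¹}) := by
  obtain ⟨s, hsB, hs0, hsO, h₁⟩ :=
    refine_oneSided O hBO hB' ((le_risoLoc O B').trans hloc.symm.le)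
  obtain ⟨s', hs'B, hs'0, hs'O, h₂⟩ :=
    refine_oneSided O hB'O hB ((le_risoLoc O B).trans hloc.le)
  exact ⟨s, s', hsB, hs'B, hs0, hs'0, hsO, hs'O, h₁, h₂⟩

end Summit.ResolutionOfSingularities.ResolutionOfSingularities.Theorems

end
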